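import Literature.AlgebraicGeometry.Resolution.ArithmeticalThreefoldsLocalDescentEmbChain1
import HarnessLib

/-!
# Cossart–Piltant 2019, Prop. 4.10: the (C4) chain re-keyed on CJS Thm. 1.4 (`B = ∅`) — part 2

Topic: `Literature/AlgebraicGeometry/Resolution` (proofs only: no new notions, no new named facts).

The chain `ArithmeticalThreefoldsLocalDescent{Steps, Kummer, KummerStableLocalRing, Layers, InertiaClimb,
InertiaStableLocalRing, InertiaHensel, DecompositionHead, MonomializationHead, Monomialization, Keyed,
EquivariantSplit}.lean` derives `CossartPiltant2019ReductionP` (Cossart–Piltant 2019, the residue-characteristic-`p`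
part of Prop. 4.10) from the local theorem, principalization, the descent inputs and — only as a PASS-THROUGH to the
rank-one reduction (C5) at its bottom — the non-embedded resolution of excellent surfaces `CossartJannsenSaito2020General`
(CJS Thm. 1.2).  Since (C5) is now served by the EMBEDDED theorem (`rankOne_reduction_of_cjsEmbedded`,
`ArithmeticalThreefoldsLocalRankReductionEmbeddedFrame.lean`), this file repeats the chain with the hypothesis
`CossartJannsenSaito2020General` replaced by `CossartJannsenSaito2020Embedded` (CJS Thm. 1.4, `B = ∅` — the type of
stub 1 of the `CleanModels` crux of the summit `ResolutionOfSingularities`); statements and proofs are otherwise those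
of the originals, verbatim (names: `…_of_emb_of_…` / `…_of_embPrinted_of_…`).

## Sources

* V. Cossart, O. Piltant, *Resolution of singularities of arithmetical threefolds*, J. Algebra 529 (2019),
  proof of Prop. 4.10 (arXiv v1: Prop. 4.8, pp. 53–54). [CossartPiltant2019]
* V. Cossart, O. Piltant, *Resolution of singularities of threefolds in positive characteristic I*, J. Algebra 320
  (2008), §§6–9. [CossartPiltant2008]
* V. Cossart, U. Jannsen, S. Saito, LNM 2270 (2020), Thm. 1.4, Cor. 1.5. [CossartJannsenSaito2020]
-/

noncomputable section

open CategoryTheory AlgebraicGeometry TopologicalSpace IsLocalRing _root_.Polynomial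
  _root_.IntermediateField

namespace Literature.AlgebraicGeometry.Resolution

universe u

/-- (RE-KEYED on Cossart–Jannsen–Saito Thm. 1.4 with `B = ∅`: statement and proof as the original of the same name with `cjs`/`printed` replaced by `emb`/`embPrinted`, the rank-one reduction (C5) being served by `rankOne_reduction_of_cjsEmbedded` instead of the non-embedded CJS Thm. 1.2, which is no longer an input.) **Cossart–Piltant 2019, Prop. 4.10 from Thm. 1.5, principalization, resolution of excellent
surfaces (embedded and non-embedded), "S is stable by G", the inertia layer and the
decomposition layer of [CoP1] Prop. 9.3**: `cossartPiltant2019ReductionP_of_emb_of_stableLocalRing`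
with `hUnram` assembled by `unramifiedDescent_of_layers`. After this theorem the transfer part
(C3)+(C4)+(C5) of the printed reduction `Thm. 1.5 ⇒ Thm. 1.1` rests on: `hDec` = [CoP1]
Prop. 9.3 for `K′ ≤ Mˢ` (printed proof complete: density, Prop. 8.1, ZMT); `hInert` =
`(LU K′) ⇒ (LU Mˢ)` for `Mˢ ≤ K′ ≤ Mⁱ` and `hStabLoc` = "S is stable by G" in totally ramified
Kummer steps — the two places where the printed argument takes invariants of a regular local
model under a Galois group without proving the model stable.
[cite: CossartPiltant2019, Props. 4.3, 4.4 and proof of Prop. 4.10 (arXiv v1: Props. 4.2, 4.3, 4.8, pp. 50–54)]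
[cite: CossartPiltant2008, Lemma 9.4, Prop. 9.3, Prop. 9.5 (HAL pp. 26–30)]
[cite: CossartJannsenSaito2020, Thm. 1.2, Cor. 1.5] -/
theorem cossartPiltant2019ReductionP_of_emb_of_layers
    (hloc : CossartPiltant2019Local.{u}) (h44 : CossartPiltant2019Principalization.{u})
    (hCJSE : CossartJannsenSaito2020Embedded.{u})
    (hEmb : ∀ (Z : Scheme.{u}) [IsIntegral Z] [IsNoetherian Z], Scheme.IsRegular Z →
      Scheme.IsExcellent Z → ∀ (X : Set Z), IsClosed X → X ≠ Set.univ → topologicalKrullDim X ≤ 2 →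
        ∃ (Z' : Scheme.{u}) (π : Z' ⟶ Z), IsProper π ∧ Function.Surjective π.base ∧
          (∃ U : Z.Opens, (U : Set Z) = Xᶜ ∧ IsIso (π ∣_ U)) ∧
          IsStrictNormalCrossingsDivisor Z' (π.base ⁻¹' X))
    (hStabLoc :
      ∀ (p : ℕ), p.Prime →
      ∀ (S : Type u) [CommRing S] [IsDomain S] [IsRegularLocalRing S],
        IsExcellentRing S → ringKrullDim S = 3 → CharP (ResidueField S) p →
        IsAdicComplete (maximalIdeal S) S →
      ∀ (E : Type u) [Field E] [Algebra S E], Function.Injective (algebraMap S E) →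
        IsAlgClosed E → Algebra.IsAlgebraic S E →
      ∀ (OE : ValuationSubring E), (∀ s : S, algebraMap S E s ∈ OE) →
        (∀ s ∈ maximalIdeal S, OE.valuation (algebraMap S E s) < 1) →
        (∀ y : OE, ∃ q : S[X], (∃ i, q.coeff i ∉ maximalIdeal S) ∧
          OE.valuation (q.eval₂ (algebraMap S E) y) < 1) →
      Nonempty OE.valuation.RankOne →
      ∀ (ℓ : ℕ), ℓ.Prime → ℓ ≠ p → ∀ (ζ : E), IsPrimitiveRoot ζ ℓ →
      ∀ (A : Subfield E), (∀ s : S, algebraMap S E s ∈ A) → ζ ∈ A →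
      ∀ (θ : E), θ ∉ A → θ ^ ℓ ∈ A → OE.valuation θ ≤ 1 →
        Module.finrank A (adjoin A ({θ} : Set E)) = ℓ → IsGalois A (adjoin A ({θ} : Set E)) →
        inertiaGroupIn OE (adjoin A ({θ} : Set E)) = ⊤ →
        (∃ t : Finset E, (t : Set E) ⊆ (adjoin A ({θ} : Set E)).toSubfield ∧
          (adjoin A ({θ} : Set E)).toSubfield ≤
            Subfield.closure (Set.range (algebraMap S E) ∪ (t : Set E)) ∧
          ∃ hTO : (Algebra.adjoin S (t : Set E)).toSubring ≤ OE.toSubring,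
            IsRegularLocalRing (Localization.AtPrime
              (Ideal.comap (Subring.inclusion hTO) (maximalIdeal OE)))) →
        (∃ t : Finset E, (t : Set E) ⊆ (adjoin A ({θ} : Set E)).toSubfield ∧
          (adjoin A ({θ} : Set E)).toSubfield ≤
            Subfield.closure (Set.range (algebraMap S E) ∪ (t : Set E)) ∧
          ∃ hTO : (Algebra.adjoin S (t : Set E)).toSubring ≤ OE.toSubring,
            IsRegularLocalRing (Localization.AtPrime
              (Ideal.comap (Subring.inclusion hTO) (maximalIdeal OE))) ∧
            ∀ (τ : adjoin A ({θ} : Set E) ≃ₐ[A] adjoin A ({θ} : Set E))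
              (x : adjoin A ({θ} : Set E)),
              (x : E) ∈ locAtCentre (Algebra.adjoin S (t : Set E)).toSubring OE →
              ((τ x : adjoin A ({θ} : Set E)) : E) ∈
                locAtCentre (Algebra.adjoin S (t : Set E)).toSubring OE))
    (hInert :
      ∀ (p : ℕ), p.Prime →
      ∀ (S : Type u) [CommRing S] [IsDomain S] [IsRegularLocalRing S],
        IsExcellentRing S → ringKrullDim S = 3 → CharP (ResidueField S) p →
        IsAdicComplete (maximalIdeal S) S →
      ∀ (E : Type u) [Field E] [Algebra S E], Function.Injective (algebraMap S E) →
        IsAlgClosed E → Algebra.IsAlgebraic S E →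
      ∀ (OE : ValuationSubring E), (∀ s : S, algebraMap S E s ∈ OE) →
        (∀ s ∈ maximalIdeal S, OE.valuation (algebraMap S E s) < 1) →
        (∀ y : OE, ∃ q : S[X], (∃ i, q.coeff i ∉ maximalIdeal S) ∧
          OE.valuation (q.eval₂ (algebraMap S E) y) < 1) →
      Nonempty OE.valuation.RankOne →
      ∀ (M : Subfield E), (∀ s : S, algebraMap S E s ∈ M) →
      ∀ (N : IntermediateField M E) [FiniteDimensional M N] [IsGalois M N] (K' : Subfield E),
        (lift (fixedField (decompositionGroupIn OE N))).toSubfield ≤ K' →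
        K' ≤ (lift (fixedField (inertiaGroupIn OE N))).toSubfield →
        (∃ t : Finset E, (t : Set E) ⊆ K' ∧
          K' ≤ Subfield.closure (Set.range (algebraMap S E) ∪ (t : Set E)) ∧
          ∃ hTO : (Algebra.adjoin S (t : Set E)).toSubring ≤ OE.toSubring,
            IsRegularLocalRing (Localization.AtPrime
              (Ideal.comap (Subring.inclusion hTO) (maximalIdeal OE)))) →
        (∃ t : Finset E, (t : Set E) ⊆ (lift (fixedField (decompositionGroupIn OE N))).toSubfield ∧
          (lift (fixedField (decompositionGroupIn OE N))).toSubfield ≤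
            Subfield.closure (Set.range (algebraMap S E) ∪ (t : Set E)) ∧
          ∃ hTO : (Algebra.adjoin S (t : Set E)).toSubring ≤ OE.toSubring,
            IsRegularLocalRing (Localization.AtPrime
              (Ideal.comap (Subring.inclusion hTO) (maximalIdeal OE)))))
    (hDec :
      ∀ (p : ℕ), p.Prime →
      ∀ (S : Type u) [CommRing S] [IsDomain S] [IsRegularLocalRing S],
        IsExcellentRing S → ringKrullDim S = 3 → CharP (ResidueField S) p →
        IsAdicComplete (maximalIdeal S) S →
      ∀ (E : Type u) [Field E] [Algebra S E], Function.Injective (algebraMap S E) →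
        IsAlgClosed E → Algebra.IsAlgebraic S E →
      ∀ (OE : ValuationSubring E), (∀ s : S, algebraMap S E s ∈ OE) →
        (∀ s ∈ maximalIdeal S, OE.valuation (algebraMap S E s) < 1) →
        (∀ y : OE, ∃ q : S[X], (∃ i, q.coeff i ∉ maximalIdeal S) ∧
          OE.valuation (q.eval₂ (algebraMap S E) y) < 1) →
      Nonempty OE.valuation.RankOne →
      ∀ (M : Subfield E), (∀ s : S, algebraMap S E s ∈ M) →
      ∀ (N : IntermediateField M E) [FiniteDimensional M N] [IsGalois M N] (K' : Subfield E),
        M ≤ K' → K' ≤ (lift (fixedField (decompositionGroupIn OE N))).toSubfield →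
        (∃ t : Finset E, (t : Set E) ⊆ K' ∧
          K' ≤ Subfield.closure (Set.range (algebraMap S E) ∪ (t : Set E)) ∧
          ∃ hTO : (Algebra.adjoin S (t : Set E)).toSubring ≤ OE.toSubring,
            IsRegularLocalRing (Localization.AtPrime
              (Ideal.comap (Subring.inclusion hTO) (maximalIdeal OE)))) →
        (∃ t : Finset E, (t : Set E) ⊆ M ∧
          M ≤ Subfield.closure (Set.range (algebraMap S E) ∪ (t : Set E)) ∧
          ∃ hTO : (Algebra.adjoin S (t : Set E)).toSubring ≤ OE.toSubring,
            IsRegularLocalRing (Localization.AtPrime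
              (Ideal.comap (Subring.inclusion hTO) (maximalIdeal OE))))) :
    CossartPiltant2019ReductionP.{u} :=
  cossartPiltant2019ReductionP_of_emb_of_stableLocalRing hloc h44 hCJSE hEmb hStabLoc
    (fun p hp S _ _ _ hS hSdim hSchar hScomp E _ _ hinj hE halg OE hSO hdom hres hrk M hSM N _ _ K'
        hMK' hK'i hLUK' => by
      haveI := hE
      haveI := halg
      exact unramifiedDescent_of_layers OE
        (cofinality_of_principalization h44 p hp S hS hSdim hSchar hScomp E hinj hE halg OE hSO hdom
          hres)
        (fun M' hSM' N' _ _ => hDec p hp S hS hSdim hSchar hScomp E hinj hE halg OE hSO hdom hres hrk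
          M' hSM' N')
        (fun M' hSM' N' _ _ => hInert p hp S hS hSdim hSchar hScomp E hinj hE halg OE hSO hdom hres
          hrk M' hSM' N')
        M hSM N K' hMK' hK'i hLUK')

/-- (RE-KEYED on Cossart–Jannsen–Saito Thm. 1.4 with `B = ∅`: statement and proof as the original of the same name with `cjs`/`printed` replaced by `emb`/`embPrinted`, the rank-one reduction (C5) being served by `rankOne_reduction_of_cjsEmbedded` instead of the non-embedded CJS Thm. 1.2, which is no longer an input.) **Cossart–Piltant 2019, Prop. 4.10 from Thm. 1.5, principalization, resolution of excellent
surfaces (embedded and non-embedded), "S is stable by G" (tame layer), an equivariant local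
uniformization of the INERTIA FIELD (inertia layer), and the decomposition layer of [CoP1]
Prop. 9.3**: `cossartPiltant2019ReductionP_of_emb_of_layers` with `hInert` discharged by
`inertLayer_descent_of_stableInertiaField` (cofinality from principalization,
`cofinality_of_principalization`). The unprinted input of the inertia layer is now `hStabI`:
given `(LU Mⁱ)` for a finite Galois `N | M` in the frame, a `Gˢ`-stable local uniformization
(`t ⊆ N`, `Mˢ ⊆ Frac S[t]`) on which every `τ ∈ Gˢ` acts trivially or moves some element of the
local ring by a `v`-unit. [cite: CossartPiltant2019, Props. 4.3, 4.4 and proof of Prop. 4.10 (arXiv v1: Props. 4.2, 4.3, 4.8, pp. 50–54)]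
[cite: CossartPiltant2008, Lemma 9.4, Prop. 9.3, Prop. 9.5 (HAL pp. 26–30)]
[cite: CossartJannsenSaito2020, Thm. 1.2, Cor. 1.5] -/
theorem cossartPiltant2019ReductionP_of_emb_of_stableInertiaField
    (hloc : CossartPiltant2019Local.{u}) (h44 : CossartPiltant2019Principalization.{u})
    (hCJSE : CossartJannsenSaito2020Embedded.{u})
    (hEmb : ∀ (Z : Scheme.{u}) [IsIntegral Z] [IsNoetherian Z], Scheme.IsRegular Z →
      Scheme.IsExcellent Z → ∀ (X : Set Z), IsClosed X → X ≠ Set.univ → topologicalKrullDim X ≤ 2 →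
        ∃ (Z' : Scheme.{u}) (π : Z' ⟶ Z), IsProper π ∧ Function.Surjective π.base ∧
          (∃ U : Z.Opens, (U : Set Z) = Xᶜ ∧ IsIso (π ∣_ U)) ∧
          IsStrictNormalCrossingsDivisor Z' (π.base ⁻¹' X))
    (hStabLoc :
      ∀ (p : ℕ), p.Prime →
      ∀ (S : Type u) [CommRing S] [IsDomain S] [IsRegularLocalRing S],
        IsExcellentRing S → ringKrullDim S = 3 → CharP (ResidueField S) p →
        IsAdicComplete (maximalIdeal S) S →
      ∀ (E : Type u) [Field E] [Algebra S E], Function.Injective (algebraMap S E) →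
        IsAlgClosed E → Algebra.IsAlgebraic S E →
      ∀ (OE : ValuationSubring E), (∀ s : S, algebraMap S E s ∈ OE) →
        (∀ s ∈ maximalIdeal S, OE.valuation (algebraMap S E s) < 1) →
        (∀ y : OE, ∃ q : S[X], (∃ i, q.coeff i ∉ maximalIdeal S) ∧
          OE.valuation (q.eval₂ (algebraMap S E) y) < 1) →
      Nonempty OE.valuation.RankOne →
      ∀ (ℓ : ℕ), ℓ.Prime → ℓ ≠ p → ∀ (ζ : E), IsPrimitiveRoot ζ ℓ →
      ∀ (A : Subfield E), (∀ s : S, algebraMap S E s ∈ A) → ζ ∈ A →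
      ∀ (θ : E), θ ∉ A → θ ^ ℓ ∈ A → OE.valuation θ ≤ 1 →
        Module.finrank A (adjoin A ({θ} : Set E)) = ℓ → IsGalois A (adjoin A ({θ} : Set E)) →
        inertiaGroupIn OE (adjoin A ({θ} : Set E)) = ⊤ →
        (∃ t : Finset E, (t : Set E) ⊆ (adjoin A ({θ} : Set E)).toSubfield ∧
          (adjoin A ({θ} : Set E)).toSubfield ≤
            Subfield.closure (Set.range (algebraMap S E) ∪ (t : Set E)) ∧
          ∃ hTO : (Algebra.adjoin S (t : Set E)).toSubring ≤ OE.toSubring,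
            IsRegularLocalRing (Localization.AtPrime
              (Ideal.comap (Subring.inclusion hTO) (maximalIdeal OE)))) →
        (∃ t : Finset E, (t : Set E) ⊆ (adjoin A ({θ} : Set E)).toSubfield ∧
          (adjoin A ({θ} : Set E)).toSubfield ≤
            Subfield.closure (Set.range (algebraMap S E) ∪ (t : Set E)) ∧
          ∃ hTO : (Algebra.adjoin S (t : Set E)).toSubring ≤ OE.toSubring,
            IsRegularLocalRing (Localization.AtPrime
              (Ideal.comap (Subring.inclusion hTO) (maximalIdeal OE))) ∧
            ∀ (τ : adjoin A ({θ} : Set E) ≃ₐ[A] adjoin A ({θ} : Set E))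
              (x : adjoin A ({θ} : Set E)),
              (x : E) ∈ locAtCentre (Algebra.adjoin S (t : Set E)).toSubring OE →
              ((τ x : adjoin A ({θ} : Set E)) : E) ∈
                locAtCentre (Algebra.adjoin S (t : Set E)).toSubring OE))
    (hStabI :
      ∀ (p : ℕ), p.Prime →
      ∀ (S : Type u) [CommRing S] [IsDomain S] [IsRegularLocalRing S],
        IsExcellentRing S → ringKrullDim S = 3 → CharP (ResidueField S) p →
        IsAdicComplete (maximalIdeal S) S →
      ∀ (E : Type u) [Field E] [Algebra S E], Function.Injective (algebraMap S E) →
        IsAlgClosed E → Algebra.IsAlgebraic S E →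
      ∀ (OE : ValuationSubring E), (∀ s : S, algebraMap S E s ∈ OE) →
        (∀ s ∈ maximalIdeal S, OE.valuation (algebraMap S E s) < 1) →
        (∀ y : OE, ∃ q : S[X], (∃ i, q.coeff i ∉ maximalIdeal S) ∧
          OE.valuation (q.eval₂ (algebraMap S E) y) < 1) →
      Nonempty OE.valuation.RankOne →
      ∀ (M : Subfield E), (∀ s : S, algebraMap S E s ∈ M) →
      ∀ (N : IntermediateField M E) [FiniteDimensional M N] [IsGalois M N],
        (∃ t : Finset E, (t : Set E) ⊆ (lift (fixedField (inertiaGroupIn OE N))).toSubfield ∧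
          (lift (fixedField (inertiaGroupIn OE N))).toSubfield ≤
            Subfield.closure (Set.range (algebraMap S E) ∪ (t : Set E)) ∧
          ∃ hTO : (Algebra.adjoin S (t : Set E)).toSubring ≤ OE.toSubring,
            IsRegularLocalRing (Localization.AtPrime
              (Ideal.comap (Subring.inclusion hTO) (maximalIdeal OE)))) →
        ∃ t : Finset E, (t : Set E) ⊆ N.toSubfield ∧
          (lift (fixedField (decompositionGroupIn OE N))).toSubfield ≤
            Subfield.closure (Set.range (algebraMap S E) ∪ (t : Set E)) ∧
          ∃ hTO : (Algebra.adjoin S (t : Set E)).toSubring ≤ OE.toSubring,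
            IsRegularLocalRing (Localization.AtPrime
              (Ideal.comap (Subring.inclusion hTO) (maximalIdeal OE))) ∧
            (∀ τ ∈ decompositionGroupIn OE N, ∀ x : N, (x : E) ∈ t → ((τ x : N) : E) ∈ t) ∧
            (∀ τ ∈ decompositionGroupIn OE N, (∀ x : N, (x : E) ∈ t → τ x = x) ∨
              ∃ x : N, (x : E) ∈ locAtCentre (Algebra.adjoin S (t : Set E)).toSubring OE ∧
                OE.valuation (((τ x : N) : E) - x) = 1))
    (hDec :
      ∀ (p : ℕ), p.Prime →
      ∀ (S : Type u) [CommRing S] [IsDomain S] [IsRegularLocalRing S],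
        IsExcellentRing S → ringKrullDim S = 3 → CharP (ResidueField S) p →
        IsAdicComplete (maximalIdeal S) S →
      ∀ (E : Type u) [Field E] [Algebra S E], Function.Injective (algebraMap S E) →
        IsAlgClosed E → Algebra.IsAlgebraic S E →
      ∀ (OE : ValuationSubring E), (∀ s : S, algebraMap S E s ∈ OE) →
        (∀ s ∈ maximalIdeal S, OE.valuation (algebraMap S E s) < 1) →
        (∀ y : OE, ∃ q : S[X], (∃ i, q.coeff i ∉ maximalIdeal S) ∧
          OE.valuation (q.eval₂ (algebraMap S E) y) < 1) →
      Nonempty OE.valuation.RankOne →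
      ∀ (M : Subfield E), (∀ s : S, algebraMap S E s ∈ M) →
      ∀ (N : IntermediateField M E) [FiniteDimensional M N] [IsGalois M N] (K' : Subfield E),
        M ≤ K' → K' ≤ (lift (fixedField (decompositionGroupIn OE N))).toSubfield →
        (∃ t : Finset E, (t : Set E) ⊆ K' ∧
          K' ≤ Subfield.closure (Set.range (algebraMap S E) ∪ (t : Set E)) ∧
          ∃ hTO : (Algebra.adjoin S (t : Set E)).toSubring ≤ OE.toSubring,
            IsRegularLocalRing (Localization.AtPrime
              (Ideal.comap (Subring.inclusion hTO) (maximalIdeal OE)))) →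
        (∃ t : Finset E, (t : Set E) ⊆ M ∧
          M ≤ Subfield.closure (Set.range (algebraMap S E) ∪ (t : Set E)) ∧
          ∃ hTO : (Algebra.adjoin S (t : Set E)).toSubring ≤ OE.toSubring,
            IsRegularLocalRing (Localization.AtPrime
              (Ideal.comap (Subring.inclusion hTO) (maximalIdeal OE))))) :
    CossartPiltant2019ReductionP.{u} :=
  cossartPiltant2019ReductionP_of_emb_of_layers hloc h44 hCJSE hEmb hStabLoc
    (fun p hp S _ _ _ hS hSdim hSchar hScomp E _ _ hinj hE halg OE hSO hdom hres hrk M hSM N _ _ K'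
        hsK' hK'i hLUK' => by
      haveI := hE
      haveI := halg
      exact inertLayer_descent_of_stableInertiaField OE
        (cofinality_of_principalization h44 p hp S hS hSdim hSchar hScomp E hinj hE halg OE hSO hdom
          hres)
        (fun M' hSM' N' _ _ => hStabI p hp S hS hSdim hSchar hScomp E hinj hE halg OE hSO hdom hres
          hrk M' hSM' N')
        M hSM N K' hsK' hK'i hLUK')
    hDec


end Literature.AlgebraicGeometry.Resolution

end
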